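import Mathlib
import HarnessLib

/-!
# ValiantsHypothesis / SymPencil — crux `EquivariantSdcNotQP` (stmt-ValiantsHypothesis-17792), line
# `birth_EquivariantSdcNotQP`, open piece (iii″) of `stub_permify`: LINEAR-LEVEL RETRACT TOOLKIT
# (reindexing, transport along equivariant isomorphisms, internal direct sums, Maschke complements)

Second toolkit file for the open piece (iii″) (see `…PermEmbeddingBridge.lean`,
`…PermRetractFrobenius.lean`, and val-width-17792-p1's `…PermEmbeddingRegular.lean`).  A LINEAR
RETRACT of a family `T : G → (V →ₗ V)` over an index type `X` is a triple
`ι : V →ₗ (X → ℂ)`, `p : (X → ℂ) →ₗ V`, `τ : G → Perm X` with `p ∘ ι = id`,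
`funLeft (τ g) ∘ ι = ι ∘ T g`, `p ∘ funLeft (τ g) = T g ∘ p` (spelled out inline; no definitions).
This file (helper of the item, `--supports stmt-ValiantsHypothesis-17792 --as helper`; 0 definitions /
0 named facts) proves the glue a Maschke-style reduction of (iii″) to IRREDUCIBLE representations needs:
* `linRetract_reindex` — reindexing along `X ≃ Y`;
* `linRetract_of_equiv` — transport along an equivariant linear isomorphism `V ≃ₗ V'`;
* `linRetract_sum` — **internal direct sums**: if `V = W₁ ⊕ W₂` with invariant summands whose
  restricted families are retracts over `X₁, X₂`, then `T` is a retract over `X₁ ⊕ X₂`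
  (`Submodule.projectionOnto`; the projections are equivariant);
* `exists_invariant_compl` — **Maschke complement by averaging** (finite `G`, `T` a homomorphism):
  an invariant subspace has an invariant complement (`π = |G|⁻¹ Σ_g T g ∘ π₀ ∘ T g⁻¹`,
  `LinearMap.isCompl_of_proj`);
* `funLeft_eq_comp` — bookkeeping.
The assembly `(iii″) ⇐ (irreducible case)` follows in `…PermEmbeddingOfIrreducible.lean`.

Honest framing: infrastructure; `stub_permify`, the crux `SymPencil.EquivariantSdcNotQP` and
`VP ≠ VNP` remain OPEN and nothing here is progress on them.
-/

noncomputable section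

set_option linter.dupNamespace false

namespace Summit.ValiantsHypothesis.ValiantsHypothesis.Theorems.SymPencilEquivariantSdcNotQP

open Module Submodule

variable {G : Type*} {V : Type*} [AddCommGroup V] [Module ℂ V]

/-- `funLeft f g = g ∘ f` (Mathlib states it pointwise). [folklore] -/
theorem funLeft_eq_comp {m n : Type*} (f : m → n) (g : n → ℂ) :
    LinearMap.funLeft ℂ ℂ f g = g ∘ f := rfl

/-! ### Reindexing and transport -/

/-- Reindexing a linear retract along a bijection of the permuted coordinates. [folklore] -/
theorem linRetract_reindex {X Y : Type*} (e : X ≃ Y) (T : G → (V →ₗ[ℂ] V))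
    (ι : V →ₗ[ℂ] (X → ℂ)) (p : (X → ℂ) →ₗ[ℂ] V) (τ : G → Equiv.Perm X)
    (hpι : p ∘ₗ ι = LinearMap.id)
    (h : ∀ g, LinearMap.funLeft ℂ ℂ (τ g) ∘ₗ ι = ι ∘ₗ T g ∧
      p ∘ₗ LinearMap.funLeft ℂ ℂ (τ g) = T g ∘ₗ p) :
    ∃ (ι' : V →ₗ[ℂ] (Y → ℂ)) (p' : (Y → ℂ) →ₗ[ℂ] V) (τ' : G → Equiv.Perm Y),
      p' ∘ₗ ι' = LinearMap.id ∧ ∀ g, LinearMap.funLeft ℂ ℂ (τ' g) ∘ₗ ι' = ι' ∘ₗ T g ∧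
        p' ∘ₗ LinearMap.funLeft ℂ ℂ (τ' g) = T g ∘ₗ p' := by
  refine ⟨LinearMap.funLeft ℂ ℂ e.symm ∘ₗ ι, p ∘ₗ LinearMap.funLeft ℂ ℂ e,
    fun g => (e.symm.trans (τ g)).trans e, ?_, fun g => ⟨?_, ?_⟩⟩
  · refine LinearMap.ext fun v => ?_
    have hv := LinearMap.congr_fun hpι v
    simp only [LinearMap.coe_comp, Function.comp_apply, LinearMap.id_apply, funLeft_eq_comp] at hv ⊢
    have : ((ι v) ∘ ⇑e.symm) ∘ ⇑e = ι v := by funext x; simp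
    rw [this, hv]
  · refine LinearMap.ext fun v => funext fun y => ?_
    have := congr_fun (LinearMap.congr_fun (h g).1 v) (e.symm y)
    simp only [LinearMap.coe_comp, Function.comp_apply, funLeft_eq_comp] at this ⊢
    simpa using this
  · refine LinearMap.ext fun w => ?_
    have := LinearMap.congr_fun (h g).2 (w ∘ e)
    simp only [LinearMap.coe_comp, Function.comp_apply, funLeft_eq_comp] at this ⊢
    have hw : (w ∘ ⇑((e.symm.trans (τ g)).trans e)) ∘ ⇑e = (w ∘ ⇑e) ∘ ⇑(τ g) := by
      funext x; simp
    rw [hw, this]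

/-- Transport of a linear retract along an equivariant linear isomorphism. [folklore] -/
theorem linRetract_of_equiv {V' : Type*} [AddCommGroup V'] [Module ℂ V'] {X : Type*}
    (T : G → (V →ₗ[ℂ] V)) (T' : G → (V' →ₗ[ℂ] V')) (e : V ≃ₗ[ℂ] V')
    (he : ∀ g, e.toLinearMap ∘ₗ T g = T' g ∘ₗ e.toLinearMap)
    (ι : V →ₗ[ℂ] (X → ℂ)) (p : (X → ℂ) →ₗ[ℂ] V) (τ : G → Equiv.Perm X)
    (hpι : p ∘ₗ ι = LinearMap.id)
    (h : ∀ g, LinearMap.funLeft ℂ ℂ (τ g) ∘ₗ ι = ι ∘ₗ T g ∧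
      p ∘ₗ LinearMap.funLeft ℂ ℂ (τ g) = T g ∘ₗ p) :
    (e.toLinearMap ∘ₗ p) ∘ₗ (ι ∘ₗ e.symm.toLinearMap) = LinearMap.id ∧
      ∀ g, LinearMap.funLeft ℂ ℂ (τ g) ∘ₗ (ι ∘ₗ e.symm.toLinearMap) =
          (ι ∘ₗ e.symm.toLinearMap) ∘ₗ T' g ∧
        (e.toLinearMap ∘ₗ p) ∘ₗ LinearMap.funLeft ℂ ℂ (τ g) = T' g ∘ₗ (e.toLinearMap ∘ₗ p) := by
  have he' : ∀ g, T g ∘ₗ e.symm.toLinearMap = e.symm.toLinearMap ∘ₗ T' g := by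
    intro g
    refine LinearMap.ext fun v' => ?_
    have := LinearMap.congr_fun (he g) (e.symm v')
    simp only [LinearMap.coe_comp, LinearEquiv.coe_coe, Function.comp_apply,
      LinearEquiv.apply_symm_apply] at this
    simp only [LinearMap.coe_comp, LinearEquiv.coe_coe, Function.comp_apply]
    rw [← this, LinearEquiv.symm_apply_apply]
  refine ⟨?_, fun g => ⟨?_, ?_⟩⟩
  · rw [LinearMap.comp_assoc, ← LinearMap.comp_assoc e.symm.toLinearMap, hpι, LinearMap.id_comp,
      ← LinearEquiv.coe_trans, LinearEquiv.symm_trans_self, LinearEquiv.refl_toLinearMap]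
  · rw [← LinearMap.comp_assoc, (h g).1, LinearMap.comp_assoc, he', LinearMap.comp_assoc]
  · rw [LinearMap.comp_assoc, (h g).2, ← LinearMap.comp_assoc, he g, LinearMap.comp_assoc]

/-! ### Internal direct sums -/

/-- **Internal direct sum of linear retracts.**  If `V = W₁ ⊕ W₂` with both summands invariant
under every `T g`, and the restricted families are linear retracts over index types `X₁, X₂`, then
`T` is a linear retract over `X₁ ⊕ X₂`. [folklore] -/
theorem linRetract_sum {X₁ X₂ : Type*} (T : G → (V →ₗ[ℂ] V)) {W₁ W₂ : Submodule ℂ V}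
    (hc : IsCompl W₁ W₂) (h₁ : ∀ g, W₁ ≤ W₁.comap (T g)) (h₂ : ∀ g, W₂ ≤ W₂.comap (T g))
    (ι₁ : W₁ →ₗ[ℂ] (X₁ → ℂ)) (p₁ : (X₁ → ℂ) →ₗ[ℂ] W₁) (τ₁ : G → Equiv.Perm X₁)
    (hpι₁ : p₁ ∘ₗ ι₁ = LinearMap.id)
    (hr₁ : ∀ g, LinearMap.funLeft ℂ ℂ (τ₁ g) ∘ₗ ι₁ = ι₁ ∘ₗ (T g).restrict (h₁ g) ∧
      p₁ ∘ₗ LinearMap.funLeft ℂ ℂ (τ₁ g) = (T g).restrict (h₁ g) ∘ₗ p₁)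
    (ι₂ : W₂ →ₗ[ℂ] (X₂ → ℂ)) (p₂ : (X₂ → ℂ) →ₗ[ℂ] W₂) (τ₂ : G → Equiv.Perm X₂)
    (hpι₂ : p₂ ∘ₗ ι₂ = LinearMap.id)
    (hr₂ : ∀ g, LinearMap.funLeft ℂ ℂ (τ₂ g) ∘ₗ ι₂ = ι₂ ∘ₗ (T g).restrict (h₂ g) ∧
      p₂ ∘ₗ LinearMap.funLeft ℂ ℂ (τ₂ g) = (T g).restrict (h₂ g) ∘ₗ p₂) :
    ∃ (ι : V →ₗ[ℂ] (X₁ ⊕ X₂ → ℂ)) (p : (X₁ ⊕ X₂ → ℂ) →ₗ[ℂ] V) (τ : G → Equiv.Perm (X₁ ⊕ X₂)),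
      p ∘ₗ ι = LinearMap.id ∧ ∀ g, LinearMap.funLeft ℂ ℂ (τ g) ∘ₗ ι = ι ∘ₗ T g ∧
        p ∘ₗ LinearMap.funLeft ℂ ℂ (τ g) = T g ∘ₗ p := by
  classical
  set π₁ : V →ₗ[ℂ] W₁ := W₁.projectionOnto W₂ hc with hπ₁
  set π₂ : V →ₗ[ℂ] W₂ := W₂.projectionOnto W₁ hc.symm with hπ₂
  -- the embedding `v ↦ (ι₁ (π₁ v), ι₂ (π₂ v))` read on `X₁ ⊕ X₂`
  let ι : V →ₗ[ℂ] (X₁ ⊕ X₂ → ℂ) :=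
    { toFun := fun v => Sum.elim (ι₁ (π₁ v)) (ι₂ (π₂ v))
      map_add' := fun v w => by
        funext s; cases s <;> simp
      map_smul' := fun c v => by
        funext s; cases s <;> simp }
  have hι : ∀ v, ι v = Sum.elim (ι₁ (π₁ v)) (ι₂ (π₂ v)) := fun v => rfl
  let p : (X₁ ⊕ X₂ → ℂ) →ₗ[ℂ] V :=
    W₁.subtype ∘ₗ p₁ ∘ₗ LinearMap.funLeft ℂ ℂ Sum.inl +
      W₂.subtype ∘ₗ p₂ ∘ₗ LinearMap.funLeft ℂ ℂ Sum.inr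
  have hp : ∀ w, p w = (p₁ (w ∘ Sum.inl) : V) + (p₂ (w ∘ Sum.inr) : V) := fun w => rfl
  refine ⟨ι, p, fun g => Equiv.sumCongr (τ₁ g) (τ₂ g), ?_, fun g => ⟨?_, ?_⟩⟩
  · refine LinearMap.ext fun v => ?_
    have e₁ := LinearMap.congr_fun hpι₁ (π₁ v)
    have e₂ := LinearMap.congr_fun hpι₂ (π₂ v)
    simp only [LinearMap.coe_comp, Function.comp_apply, LinearMap.id_apply] at e₁ e₂
    simp only [LinearMap.coe_comp, Function.comp_apply, LinearMap.id_apply, hp, hι,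
      Sum.elim_comp_inl, Sum.elim_comp_inr]
    rw [e₁, e₂]
    exact Submodule.projection_add_projection_eq_self hc v
  · -- equivariance of the embedding: the projections are equivariant
    have hπ₁T : ∀ v, π₁ (T g v) = (T g).restrict (h₁ g) (π₁ v) := by
      intro v
      have hv := Submodule.projection_add_projection_eq_self hc v
      -- decompose `v = v₁ + v₂` and apply `T g`
      apply Subtype.ext
      have h1 : (T g (π₁ v : V)) ∈ W₁ := h₁ g (π₁ v).2
      have h2 : (T g (π₂ v : V)) ∈ W₂ := h₂ g (π₂ v).2
      have hTv : T g v = T g (π₁ v : V) + T g (π₂ v : V) := by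
        conv_lhs => rw [← hv]
        rw [map_add]; rfl
      rw [LinearMap.coe_restrict_apply, hTv, map_add, hπ₁,
        Submodule.projectionOnto_apply_of_mem_left _ h1,
        (Submodule.projectionOnto_apply_eq_zero_iff _).2 h2, add_zero]
    have hπ₂T : ∀ v, π₂ (T g v) = (T g).restrict (h₂ g) (π₂ v) := by
      intro v
      have hv := Submodule.projection_add_projection_eq_self hc v
      apply Subtype.ext
      have h1 : (T g (π₁ v : V)) ∈ W₁ := h₁ g (π₁ v).2
      have h2 : (T g (π₂ v : V)) ∈ W₂ := h₂ g (π₂ v).2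
      have hTv : T g v = T g (π₁ v : V) + T g (π₂ v : V) := by
        conv_lhs => rw [← hv]
        rw [map_add]; rfl
      rw [LinearMap.coe_restrict_apply, hTv, map_add, hπ₂,
        Submodule.projectionOnto_apply_of_mem_left _ h2,
        (Submodule.projectionOnto_apply_eq_zero_iff _).2 h1, zero_add]
    refine LinearMap.ext fun v => funext fun s => ?_
    have e₁ := congr_fun (LinearMap.congr_fun (hr₁ g).1 (π₁ v))
    have e₂ := congr_fun (LinearMap.congr_fun (hr₂ g).1 (π₂ v))
    simp only [LinearMap.coe_comp, Function.comp_apply, funLeft_eq_comp] at e₁ e₂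
    cases s with
    | inl x =>
      have := e₁ x
      simp only [LinearMap.coe_comp, Function.comp_apply, funLeft_eq_comp, hι,
        Equiv.sumCongr_apply, Sum.map_inl, Sum.elim_inl, hπ₁T, this]
    | inr y =>
      have := e₂ y
      simp only [LinearMap.coe_comp, Function.comp_apply, funLeft_eq_comp, hι,
        Equiv.sumCongr_apply, Sum.map_inr, Sum.elim_inr, hπ₂T, this]
  · refine LinearMap.ext fun w => ?_
    have e₁ := LinearMap.congr_fun (hr₁ g).2 (w ∘ Sum.inl)
    have e₂ := LinearMap.congr_fun (hr₂ g).2 (w ∘ Sum.inr)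
    simp only [LinearMap.coe_comp, Function.comp_apply, funLeft_eq_comp] at e₁ e₂
    simp only [LinearMap.coe_comp, Function.comp_apply, funLeft_eq_comp, hp, map_add]
    have hw1 : (w ∘ ⇑(Equiv.sumCongr (τ₁ g) (τ₂ g))) ∘ Sum.inl = (w ∘ Sum.inl) ∘ τ₁ g := by
      funext x; simp
    have hw2 : (w ∘ ⇑(Equiv.sumCongr (τ₁ g) (τ₂ g))) ∘ Sum.inr = (w ∘ Sum.inr) ∘ τ₂ g := by
      funext x; simp
    rw [hw1, hw2, e₁, e₂, LinearMap.coe_restrict_apply, LinearMap.coe_restrict_apply]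

/-! ### Maschke complements by averaging -/

/-- **Maschke complement** (averaged projection; no group algebra needed).  For a finite group
acting linearly through a homomorphism `T`, every invariant subspace has an invariant complement.
[folklore] -/
theorem exists_invariant_compl [Group G] [Finite G] [FiniteDimensional ℂ V]
    (T : G →* (V →ₗ[ℂ] V)) {W : Submodule ℂ V} (hW : ∀ g, W ≤ W.comap (T g)) :
    ∃ W' : Submodule ℂ V, IsCompl W W' ∧ ∀ g, W' ≤ W'.comap (T g) := by
  classical
  haveI : Fintype G := Fintype.ofFinite G
  obtain ⟨C, hC⟩ := W.exists_isCompl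
  set π₀ : V →ₗ[ℂ] V := W.subtype ∘ₗ W.projectionOnto C hC with hπ₀
  have hTT : ∀ g : G, T g ∘ₗ T g⁻¹ = LinearMap.id := by
    intro g; rw [← Module.End.mul_eq_comp, ← map_mul, mul_inv_cancel, map_one, Module.End.one_eq_id]
  have hTT' : ∀ (g : G) v, T g (T g⁻¹ v) = v := fun g v => LinearMap.congr_fun (hTT g) v
  set π : V →ₗ[ℂ] V := ((Fintype.card G : ℂ)⁻¹) • ∑ g : G, T g ∘ₗ π₀ ∘ₗ T g⁻¹ with hπ
  have hcard : (Fintype.card G : ℂ) ≠ 0 := by exact_mod_cast Fintype.card_ne_zero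
  -- `π` lands in `W`
  have hπW : ∀ v, π v ∈ W := by
    intro v
    simp only [hπ, LinearMap.smul_apply, LinearMap.sum_apply, LinearMap.coe_comp, Function.comp_apply]
    refine Submodule.smul_mem _ _ (Submodule.sum_mem _ fun g _ => ?_)
    exact hW g (by rw [hπ₀]; simp)
  -- `π` fixes `W`
  have hπfix : ∀ w ∈ W, π w = w := by
    intro w hw
    have hterm : ∀ g : G, T g (π₀ (T g⁻¹ w)) = w := by
      intro g
      have hw' : T g⁻¹ w ∈ W := hW g⁻¹ hw
      rw [hπ₀, LinearMap.comp_apply, Submodule.projectionOnto_apply_of_mem_left _ hw',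
        Submodule.subtype_apply, hTT']
    simp only [hπ, LinearMap.smul_apply, LinearMap.sum_apply, LinearMap.coe_comp, Function.comp_apply,
      hterm, Finset.sum_const, Finset.card_univ]
    rw [← Nat.cast_smul_eq_nsmul ℂ, smul_smul, inv_mul_cancel₀ hcard, one_smul]
  -- `π` is equivariant
  have hπeq : ∀ h : G, π ∘ₗ T h = T h ∘ₗ π := by
    intro h
    refine LinearMap.ext fun v => ?_
    simp only [hπ, LinearMap.coe_comp, Function.comp_apply, LinearMap.smul_apply, LinearMap.sum_apply,
      map_smul, map_sum]
    congr 1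
    refine Fintype.sum_equiv (Equiv.mulLeft h⁻¹) _ _ fun g => ?_
    simp only [Equiv.coe_mulLeft, _root_.mul_inv_rev, inv_inv, map_mul, Module.End.mul_apply, hTT']
  -- the complement
  set f : V →ₗ[ℂ] W := LinearMap.codRestrict W π hπW with hf
  have hproj : ∀ x : W, f x = x := fun x => Subtype.ext (hπfix x x.2)
  refine ⟨LinearMap.ker f, LinearMap.isCompl_of_proj hproj, fun g v hv => ?_⟩
  rw [Submodule.mem_comap, LinearMap.mem_ker]
  rw [LinearMap.mem_ker] at hv
  apply Subtype.ext
  have h0 : π v = 0 := by simpa [hf] using congrArg Subtype.val hv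
  have := LinearMap.congr_fun (hπeq g) v
  simp only [LinearMap.coe_comp, Function.comp_apply, h0, map_zero] at this
  simpa [hf] using this

end Summit.ValiantsHypothesis.ValiantsHypothesis.Theorems.SymPencilEquivariantSdcNotQP

end
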